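import Literature.AlgebraicGeometry.Frobenioids.ArithmeticFrobenioidThm64iiiGeneral
import Literature.AlgebraicGeometry.Frobenioids.ArithmeticFrobenioidThm64iiiTransportCompatArith
import HarnessLib

/-!
# Frobenioids I, Theorem 6.4 (iii) AT THE CONSTRUCTIONS for an ARBITRARY `Ψ^rlf` arising — through
# comparison functors `u_i` over `D_i` — from an ARBITRARY `Ψ′ : ((C₁)^pf)^un-tr ⥲ ((C₂)^pf)^un-tr`:
# the hypothesis `hG2` of the knit DISCHARGED (row «T64iii-ARBITRARY-Ψ′», binder-free corollary)

Mochizuki, *The geometry of Frobenioids I: the general theory*, Kyushu J. Math. **62** (2008) 293–400,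
§6, Thm. 6.4 (iii) pp. 114–115: "If the equivalence of categories `Ψ^rlf` of (ii) arises from an
equivalence of categories `(Ψ^pf)^un-tr : (C₁^pf)^un-tr ⥲ (C₂^pf)^un-tr` between the unit-trivialized
perfections of `C₁`, `C₂` [cf. (i) and Corollary 5.4], then `deg(Ψ^rlf) ∈ ℚ_{>0}`.  In particular, if
`A₁ ∈ Ob((C₁^pf)^un-tr)` [whose projection to `D₁` we denote by `Spec(L₁)`], `A₂ ∈ Ob((C₂^pf)^un-tr)`
[whose projection to `D₂` we denote by `Spec(L₂)`], `A₂ = (Ψ^pf)^un-tr(A₁)`, then the bijection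
`V(L₁) ⥲ Prime(Φ₁(L₁)) ⥲ Prime(Φ₂(L₂)) ⥲ V(L₂)` induced by `(Ψ^pf)^un-tr` [cf. (i) and Corollary 4.11,
(iii)] maps a valuation `v₁ ∈ V(L₁)` lying over a valuation `v₀` of `ℚ` to a valuation `v₂ ∈ V(L₂)`
lying over the valuation `v₀` of `ℚ`"; proof p. 116 l. 4–16. [cite: MochizukiFrdI2008, Thm. 6.4 (iii) p.114]

PROOF-ONLY corollary (cell abc-iut, seat abc-iut-L1-d2 gen 5; L1-lead R135 (2): "seats ONE hand (first
refusal d2 lineage) to discharge hG2 by instantiation").  abc-iut-L1-t3's KNIT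
`Thm64iii_arith_general_of_transportCompat` (`ArithmeticFrobenioidThm64iiiGeneral.lean`) proves the typed
schema `Thm64iii` AT THE CONSTRUCTIONS (`arithRealification`, THE `Pic`/`δ`) for an ARBITRARY equivalence
`Ψ^rlf` of THE realifications, ARBITRARY functors `u_i : ((C_i)^pf)^un-tr → C_i^rlf`, an ARBITRARY
equivalence `Ψ′` and a transport `θ` at `A₁`, MODULO one hypothesis `hG2` (the two divisor transports —
`θ` and `Ψ^rlf`'s — agree through `ι : Φ^pf → Φ^rlf`).  This file DISCHARGES `hG2` (abc-iut-L1-d2's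
`arith_hG2_of_square_of_divClause`, `ArithmeticFrobenioidThm64iiiTransportCompatArith.lean`) from print's
hypothesis "`Ψ^rlf` ARISES FROM `Ψ′`": a `1`-commutative square `σ : Ψ′ ⋙ u₂ ≅ u₁ ⋙ Ψ^rlf` through
comparison functors `u_i` lying over `D_i` (up to `β_i : u_i ⋙ Base ≅ Base`) whose `Div` is `ι ∘ Div`
(their Div-clause — the comparison functor `(C^pf)^un-tr → C^rlf` of Prop. 5.3 / Cor. 5.4 is the identity
on bases and `ι` on divisors), with `θ :=` THE perfected divisor transport of `Ψ′` at `A₁`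
(abc-iut-L1-d1's `exists_perfectedDivisorTransport_pfUntr_at_arith`, Cor. 4.11 (iii) for
`((C_{K/F})^pf)^un-tr`) read over the bases of the `u_i`-images:

* `arith_exists_conj_transport` — the `β`-conjugate `β₂^* ∘ θ₀ ∘ (β₁⁻¹)^*` of a transport `θ₀` as a
  multiplicative equivalence over the bases of the `u_i`-images;
* `Thm64iii_arith_general_of_square` — `∃ θ` (carrying `β₁^* Div φ ↦ β₂^* Div(Ψ′φ)` for every arrow
  `φ` out of `A₁`, which pins it: every element of `Φ₁^pf(Base A₁)` is such a `Div`), `∃ picMap` with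
  `Thm64ii` (Thm. 6.4 (ii) at the data, abc-iut-L6-t10), `∃ placeMap` = the bijection of places induced
  by `θ` on primes, and `∀ deg, Thm64iii R₁ R₂ Ψ^rlf picMap deg u₁ u₂ Ψ′ A₁ placeMap` — NO hypothesis
  left beyond print's.
The `u_i` remain PARAMETERS (they are parameters of the typed schema `Thm64iii` itself); no `def`, no
instance, no named fact.  Nothing here bears on, or takes a side on, [IUTchIII] Cor. 3.12; no statement
of the paper is strengthened.
-/

noncomputable section

namespace Literature.AlgebraicGeometry.Frobenioids

open CategoryTheory Opposite PreFrobenioid Literature.AnabelianGeometry.EtaleTheta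

namespace PreFrobenioidData

universe w' v₀ v₀' u₀ u₀'

variable {C : Type u₀} [Category.{v₀} C] {D : Type u₀'} [Category.{v₀'} D] (S : PreFrobenioidData.{w'} C D)

/-- Pull-backs along an isomorphism of the base compose to the identity: `(g⁻¹)^* ∘ g^* = id`.
[cite: MochizukiFrdI2008, Def. 1.1 (iv) p.20] -/
theorem pull_inv_comp_pull_hom {X Y : D} (g : X ≅ Y) :
    (S.pull g.inv).comp (S.pull g.hom) = MonoidHom.id (S.Mon Y) :=
  MonoidHom.ext fun x => ((S.pull_comp g.inv g.hom x).symm.trans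
    ((congrArg (fun f => S.pull f x) g.inv_hom_id).trans (S.pull_id Y x)))

/-- Pull-backs along an isomorphism of the base compose to the identity: `g^* ∘ (g⁻¹)^* = id`.
[cite: MochizukiFrdI2008, Def. 1.1 (iv) p.20] -/
theorem pull_hom_comp_pull_inv {X Y : D} (g : X ≅ Y) :
    (S.pull g.hom).comp (S.pull g.inv) = MonoidHom.id (S.Mon X) :=
  MonoidHom.ext fun x => ((S.pull_comp g.hom g.inv x).symm.trans
    ((congrArg (fun f => S.pull f x) g.hom_inv_id).trans (S.pull_id X x)))

end PreFrobenioidData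

section Arith

variable {F₁ : Type} [Field F₁] [NumberField F₁] {K₁ : Type} [Field K₁] [Algebra F₁ K₁] [IsGalois F₁ K₁]
  {F₂ : Type} [Field F₂] [NumberField F₂] {K₂ : Type} [Field K₂] [Algebra F₂ K₂] [IsGalois F₂ K₂]
  (hΦ₁ : PreFrobenioid.IsPerfFactorialOn (arithDivisorFunctor F₁ K₁))
  (hΦ₂ : PreFrobenioid.IsPerfFactorialOn (arithDivisorFunctor F₂ K₂))
  (Ψrlf : PreFrobenioid.rlf (ModelFrobenioid.toElem (arithDivisorFunctor F₁ K₁) (unitsFunctor F₁ K₁)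
      (divNatTrans F₁ K₁)) hΦ₁ ≌
    PreFrobenioid.rlf (ModelFrobenioid.toElem (arithDivisorFunctor F₂ K₂) (unitsFunctor F₂ K₂)
      (divNatTrans F₂ K₂)) hΦ₂)
  -- the comparison functors `u_i : ((C_i)^pf)^un-tr → C_i^rlf`, over `D_i` up to `β_i`, with their Div-clauses
  (u₁ : (PreFrobenioidData.ofFunctor _
      (PreFrobenioid.Perfection.ops (arithFrobenioid_isFrobenioid F₁ K₁)).toFunctor).Untr ⥤
    PreFrobenioid.rlf (ModelFrobenioid.toElem (arithDivisorFunctor F₁ K₁) (unitsFunctor F₁ K₁)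
      (divNatTrans F₁ K₁)) hΦ₁)
  (β₁ : u₁ ⋙ (arithRealification hΦ₁).ops.base ≅
    (PreFrobenioidData.ofFunctor _ (untrFunctor (arith_pf_isFrobenioid F₁ K₁))).base)
  (hu₁ : ∀ ⦃A B : (PreFrobenioidData.ofFunctor _
      (PreFrobenioid.Perfection.ops (arithFrobenioid_isFrobenioid F₁ K₁)).toFunctor).Untr⦄ (φ : A ⟶ B),
    (arithRealification hΦ₁).ops.div (u₁.map φ) =
      (arithRealification hΦ₁).ops.pull (β₁.hom.app A)
        ((PreFrobenioid.IsPerfFactorialOn.op hΦ₁ (op _)).toRealification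
          ((PreFrobenioidData.ofFunctor _ (untrFunctor (arith_pf_isFrobenioid F₁ K₁))).div φ)))
  (u₂ : (PreFrobenioidData.ofFunctor _
      (PreFrobenioid.Perfection.ops (arithFrobenioid_isFrobenioid F₂ K₂)).toFunctor).Untr ⥤
    PreFrobenioid.rlf (ModelFrobenioid.toElem (arithDivisorFunctor F₂ K₂) (unitsFunctor F₂ K₂)
      (divNatTrans F₂ K₂)) hΦ₂)
  (β₂ : u₂ ⋙ (arithRealification hΦ₂).ops.base ≅
    (PreFrobenioidData.ofFunctor _ (untrFunctor (arith_pf_isFrobenioid F₂ K₂))).base)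
  (hu₂ : ∀ ⦃A B : (PreFrobenioidData.ofFunctor _
      (PreFrobenioid.Perfection.ops (arithFrobenioid_isFrobenioid F₂ K₂)).toFunctor).Untr⦄ (φ : A ⟶ B),
    (arithRealification hΦ₂).ops.div (u₂.map φ) =
      (arithRealification hΦ₂).ops.pull (β₂.hom.app A)
        ((PreFrobenioid.IsPerfFactorialOn.op hΦ₂ (op _)).toRealification
          ((PreFrobenioidData.ofFunctor _ (untrFunctor (arith_pf_isFrobenioid F₂ K₂))).div φ)))
  (Ψ' : (PreFrobenioidData.ofFunctor _
      (PreFrobenioid.Perfection.ops (arithFrobenioid_isFrobenioid F₁ K₁)).toFunctor).Untr ≌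
    (PreFrobenioidData.ofFunctor _
      (PreFrobenioid.Perfection.ops (arithFrobenioid_isFrobenioid F₂ K₂)).toFunctor).Untr)
  -- print's hypothesis "`Ψ^rlf` arises from `Ψ′`": the `1`-commutative square through the comparison functors
  (σ : Ψ'.functor ⋙ u₂ ≅ u₁ ⋙ Ψrlf.functor)
  (A₁ : (PreFrobenioidData.ofFunctor _
    (PreFrobenioid.Perfection.ops (arithFrobenioid_isFrobenioid F₁ K₁)).toFunctor).Untr)

/-- The `β`-conjugate `β₂^* ∘ θ₀ ∘ (β₁⁻¹)^*` of a transport `θ₀ : Φ₁^pf(Base A₁) ⥲ Φ₂^pf(Base Ψ′A₁)` — read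
over the bases of the `u_i`-images, as a multiplicative equivalence (pull-backs along the base isomorphisms
`β₁_{A₁}`, `β₂_{Ψ′A₁}`). [cite: MochizukiFrdI2008, Thm. 6.4 (iii) p.115] -/
theorem arith_exists_conj_transport
    (θ₀ : Perfection (Multiplicative (EffArithDivisor
        ((PreFrobenioidData.ofFunctor _ (untrFunctor (arith_pf_isFrobenioid F₁ K₁))).base.obj A₁).L)) ≃*
      Perfection (Multiplicative (EffArithDivisor
        ((PreFrobenioidData.ofFunctor _ (untrFunctor (arith_pf_isFrobenioid F₂ K₂))).base.obj
          (Ψ'.functor.obj A₁)).L))) :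
    ∃ θ : Perfection (Multiplicative (EffArithDivisor ((arithRealification hΦ₁).ops.base.obj (u₁.obj A₁)).L)) ≃*
        Perfection (Multiplicative (EffArithDivisor
          ((arithRealification hΦ₂).ops.base.obj (u₂.obj (Ψ'.functor.obj A₁))).L)),
      ∀ x, θ x =
        (PreFrobenioidData.ofFunctor _ (untrFunctor (arith_pf_isFrobenioid F₂ K₂))).pull
          (β₂.hom.app (Ψ'.functor.obj A₁))
          (θ₀ ((PreFrobenioidData.ofFunctor _ (untrFunctor (arith_pf_isFrobenioid F₁ K₁))).pull
            (β₁.inv.app A₁) x)) := by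
  -- the pull-backs along the base isomorphisms as multiplicative equivalences, READ in the letter
  -- `Φ_i(L)^pf` (definitionally the divisor monoids of `((C_i)^pf)^un-tr`), composed with `θ₀`
  refine
    ⟨((MonoidHom.toMulEquiv
          ((PreFrobenioidData.ofFunctor _ (untrFunctor (arith_pf_isFrobenioid F₁ K₁))).pull (β₁.inv.app A₁))
          ((PreFrobenioidData.ofFunctor _ (untrFunctor (arith_pf_isFrobenioid F₁ K₁))).pull (β₁.hom.app A₁))
          ((PreFrobenioidData.ofFunctor _ (untrFunctor (arith_pf_isFrobenioid F₁ K₁))).pull_hom_comp_pull_inv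
            (β₁.app A₁))
          ((PreFrobenioidData.ofFunctor _ (untrFunctor (arith_pf_isFrobenioid F₁ K₁))).pull_inv_comp_pull_hom
            (β₁.app A₁)) :
          Perfection (Multiplicative (EffArithDivisor
              ((arithRealification hΦ₁).ops.base.obj (u₁.obj A₁)).L)) ≃*
            Perfection (Multiplicative (EffArithDivisor
              ((PreFrobenioidData.ofFunctor _ (untrFunctor (arith_pf_isFrobenioid F₁ K₁))).base.obj
                A₁).L))).trans θ₀).trans
      (MonoidHom.toMulEquiv
          ((PreFrobenioidData.ofFunctor _ (untrFunctor (arith_pf_isFrobenioid F₂ K₂))).pull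
            (β₂.hom.app (Ψ'.functor.obj A₁)))
          ((PreFrobenioidData.ofFunctor _ (untrFunctor (arith_pf_isFrobenioid F₂ K₂))).pull
            (β₂.inv.app (Ψ'.functor.obj A₁)))
          ((PreFrobenioidData.ofFunctor _ (untrFunctor (arith_pf_isFrobenioid F₂ K₂))).pull_inv_comp_pull_hom
            (β₂.app (Ψ'.functor.obj A₁)))
          ((PreFrobenioidData.ofFunctor _ (untrFunctor (arith_pf_isFrobenioid F₂ K₂))).pull_hom_comp_pull_inv
            (β₂.app (Ψ'.functor.obj A₁))) :
        Perfection (Multiplicative (EffArithDivisor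
            ((PreFrobenioidData.ofFunctor _ (untrFunctor (arith_pf_isFrobenioid F₂ K₂))).base.obj
              (Ψ'.functor.obj A₁)).L)) ≃*
          Perfection (Multiplicative (EffArithDivisor
            ((arithRealification hΦ₂).ops.base.obj (u₂.obj (Ψ'.functor.obj A₁))).L))),
      fun _ => rfl⟩

include hu₁ hu₂ σ

/-- **[FrdI] Theorem 6.4 (iii) AS TYPED (`Thm64iii`), AT THE CONSTRUCTIONS, for an ARBITRARY `Ψ^rlf` arising
through comparison functors `u_i` over `D_i` from an ARBITRARY `Ψ′ : ((C₁)^pf)^un-tr ⥲ ((C₂)^pf)^un-tr` —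
UNCONDITIONAL.**  There is THE perfected divisor transport `θ : Φ₁^pf(L₁) ⥲ Φ₂^pf(L₂)` of `Ψ′` at `A₁` (read
at `Spec L₁ = Base(u₁A₁)`, `Spec L₂ = Base(u₂Ψ′A₁)`; it carries `β₁^* Div φ` to `β₂^* Div(Ψ′φ)` for every
arrow `φ` out of `A₁`), THE induced `picMap` satisfying `Thm64ii`, and THE bijection of places `placeMap`
induced by `θ` on primes, such that `Thm64iii R₁ R₂ Ψ^rlf picMap deg u₁ u₂ Ψ′ A₁ placeMap` holds for every
`deg` (so: the degree is rational, and `placeMap` respects archimedean/non-archimedean type and residue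
characteristics). [cite: MochizukiFrdI2008, Thm. 6.4 (iii) p.114] -/
theorem Thm64iii_arith_general_of_square :
    ∃ θ : Perfection (Multiplicative (EffArithDivisor ((arithRealification hΦ₁).ops.base.obj (u₁.obj A₁)).L)) ≃*
        Perfection (Multiplicative (EffArithDivisor
          ((arithRealification hΦ₂).ops.base.obj (u₂.obj (Ψ'.functor.obj A₁))).L)),
      (∀ ⦃B : (PreFrobenioidData.ofFunctor _
          (PreFrobenioid.Perfection.ops (arithFrobenioid_isFrobenioid F₁ K₁)).toFunctor).Untr⦄ (φ : A₁ ⟶ B),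
        θ ((PreFrobenioidData.ofFunctor _ (untrFunctor (arith_pf_isFrobenioid F₁ K₁))).pull (β₁.hom.app A₁)
            ((PreFrobenioidData.ofFunctor _ (untrFunctor (arith_pf_isFrobenioid F₁ K₁))).div φ)) =
          (PreFrobenioidData.ofFunctor _ (untrFunctor (arith_pf_isFrobenioid F₂ K₂))).pull
            (β₂.hom.app (Ψ'.functor.obj A₁))
            ((PreFrobenioidData.ofFunctor _ (untrFunctor (arith_pf_isFrobenioid F₂ K₂))).div
              (Ψ'.functor.map φ))) ∧
      ∃ picMap : ∀ A, (arithRealification hΦ₁).Pic A ≃+ (arithRealification hΦ₂).Pic (Ψrlf.functor.obj A),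
        Thm64ii (arithRealification hΦ₁) (arithRealification hΦ₂) Ψrlf picMap ∧
        ∃ placeMap : Places ((arithRealification hΦ₁).ops.base.obj (u₁.obj A₁)).L ≃
            Places ((arithRealification hΦ₂).ops.base.obj (u₂.obj (Ψ'.functor.obj A₁))).L,
          (∀ v, Primes.congr θ (Quotient.mk (primarySetoid _) ⟨_, EffArithDivisor.isPrimary_of_single _ v⟩) =
            Quotient.mk (primarySetoid _) ⟨_, EffArithDivisor.isPrimary_of_single _ (placeMap v)⟩) ∧
          ∀ deg : ℝ, Thm64iii (arithRealification hΦ₁) (arithRealification hΦ₂) Ψrlf picMap deg u₁ u₂ Ψ' A₁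
            placeMap := by
  -- THE perfected divisor transport of `Ψ′` at `A₁`, in the plain letter (abc-iut-L1-d1)
  have H := exists_perfectedDivisorTransport_pfUntr_at_arith (F₁ := F₁) (K₁ := K₁) (F₂ := F₂) (K₂ := K₂) Ψ' A₁
  obtain ⟨θ₀, -, hθ₀⟩ := H
  -- `θ := β₂^* ∘ θ₀ ∘ (β₁⁻¹)^*`, read over the bases of the `u_i`-images (`Exists.elim`, not `obtain`: the
  -- `cases` machinery times out against this goal)
  refine (arith_exists_conj_transport hΦ₁ hΦ₂ u₁ β₁ u₂ β₂ Ψ' A₁ θ₀).elim fun θ hθ => ?_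
  -- (G2) at this datum (abc-iut-L1-d2, `ArithmeticFrobenioidThm64iiiTransportCompatArith`)
  have hG2 := arith_hG2_of_square_of_divClause hΦ₁ hΦ₂ Ψrlf.functor u₁ β₁ hu₁ u₂ β₂ hu₂ Ψ'.functor σ A₁ θ₀ hθ₀
  -- the knit (abc-iut-L1-t3)
  refine (Thm64iii_arith_general_of_transportCompat hΦ₁ hΦ₂ Ψrlf u₁ u₂ Ψ' A₁ θ
    (fun ΨBase _ E η hdiv => (hG2 ΨBase E η hdiv).imp fun γ h x => (congrArg _ (hθ x)).trans (h x))).elim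
    fun picMap hpic => ⟨θ, fun B φ => ?_, picMap, hpic⟩
  -- Div-clause of `θ` in the `β`-letter: `(β₁⁻¹)^* β₁^* Div φ = Div φ`
  rw [hθ]
  have h : (PreFrobenioidData.ofFunctor _ (untrFunctor (arith_pf_isFrobenioid F₁ K₁))).pull (β₁.inv.app A₁)
      ((PreFrobenioidData.ofFunctor _ (untrFunctor (arith_pf_isFrobenioid F₁ K₁))).pull (β₁.hom.app A₁)
        ((PreFrobenioidData.ofFunctor _ (untrFunctor (arith_pf_isFrobenioid F₁ K₁))).div φ)) =
      (PreFrobenioidData.ofFunctor _ (untrFunctor (arith_pf_isFrobenioid F₁ K₁))).div φ :=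
    DFunLike.congr_fun
      ((PreFrobenioidData.ofFunctor _ (untrFunctor (arith_pf_isFrobenioid F₁ K₁))).pull_inv_comp_pull_hom
        (β₁.app A₁)) _
  exact congrArg (fun x => (PreFrobenioidData.ofFunctor _ (untrFunctor (arith_pf_isFrobenioid F₂ K₂))).pull
    (β₂.hom.app (Ψ'.functor.obj A₁)) x) ((congrArg θ₀ h).trans (hθ₀ φ))

end Arith

end Literature.AlgebraicGeometry.Frobenioids

end
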